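import Summits.Schanuel.Schanuel.Theorems.RootDecomp1BFinitePinningFloor03

/-!
# `RootDecomp1BFinitePinningFloor` — part 04 of 04 (`RootDecomp1BFinitePinningFloor04`): §7 the K5-X REDUCTION (`KleinPolarCellOne`, `spanOnePi`, `exists_pinned_shear_moving`, `kFiveX_reduction`, `kFiveX_of_u₀_not_mem`); §8 K5-X GRANTED `SchanuelRank 3` (`linearIndependent_piI_ℓ₀_ℓ₀I`, `Kπℓ`, `u₀_not_mem_spanOnePi_of_schanuelRank_three`, `kFiveX_of_schanuelRank_three`, `kleinPolarCellOne_false_without_channel_beyond_periods_of_schanuelRank_three`)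

Part 4 of the port of the lens-4 gen-23 kernel `FinitePinningFloor.lean` (see part 01 for the overview, the construction of pinned shears and the reading for the crux). PORT in four parts (≤ 400 lines each, shared namespace `Summit.Schanuel.Schanuel.Theorems.RootDecomp1BFinitePinningFloor`, each part importing the previous; `--supports stmt-Schanuel-24622`) of the decomp-schanuel lens-4 kernel file `HOME/decomp-schanuel-lens-4/g23/FinitePinningFloor.lean` (gen 23, 2026-08-30, sha256 be17678cd9687711…; `lean check` rc 0 · 0 sorry · standard axioms). 
-/

noncomputable section

open Complex

namespace Summit.Schanuel.Schanuel.Theorems.RootDecomp1BFinitePinningFloor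

open Summit.Schanuel.Schanuel.Theorems.RootDecomp1BTranscendencePackageFloor
open Summit.Schanuel.Schanuel.Theorems.RootDecomp1BPeriodKernelFloor
open Literature.NumberTheory.Transcendental (nesterenko baker_holds SchanuelRank transcendental_pi_holds)

/-! ## §1 Helpers (part-local copies of the private helpers of the kernel file) -/

/-- An element of an intermediate field `K` is algebraic over `K`. [folklore] -/
private theorem alg_of_mem {K : IntermediateField ℚ ℂ} {x : ℂ} (hx : x ∈ K) : IsAlgebraic K x :=
  isAlgebraic_algebraMap (⟨x, hx⟩ : K)

/-- `2` is algebraic. [folklore] -/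
private theorem alg_two : IsAlgebraic ℚ (2 : ℂ) := by
  have h : IsAlgebraic ℚ ((2 : ℕ) : ℂ) := isAlgebraic_nat 2
  simpa using h

/-- `-1` is algebraic. [folklore] -/
private theorem alg_neg_one : IsAlgebraic ℚ (-1 : ℂ) := by
  have h : IsAlgebraic ℚ ((-1 : ℤ) : ℂ) := isAlgebraic_int (-1)
  simpa using h

/-- `i` is algebraic. [folklore] -/
private theorem alg_I : IsAlgebraic ℚ I := mem_Qb_iff.mp I_mem_Qb

/-! ## §7 The K5-X REDUCTION: a model with the period package failing the LENGTH-ONE cell `X_E(1)`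
exists as soon as ONE real pair `(r, s)` off `A ⊕ Aπ` with `trdeg ℚ(r, e^s, e^{is}) ≤ 1` is
certified; the candidate `(2cos log 2, log 2)` of part TPF04 needs exactly `2cos log 2 ∉ A ⊕ Aπ` -/

/-- The LENGTH-ONE Klein-polar cell of `E` at a real `r`: `trdeg ℚ(r, ir, E r, E(ir)) ≥ 2` — the
`m = 1` instance of `KleinPolarE E` (the name is ours). [folklore] -/
def KleinPolarCellOne (E : ℂ → ℂ) (r : ℝ) : Prop :=
  ((1 + 1 : ℕ) : Cardinal) ≤ Algebra.trdeg ℚ ↥(IntermediateField.adjoin ℚ (Set.range (Fin.append (fun j => (((![r] : Fin 1 → ℝ) j : ℝ) : ℂ)) (fun j => (((![r] : Fin 1 → ℝ) j : ℝ) : ℂ) * Complex.I)) ∪ Set.range (E ∘ Fin.append (fun j => (((![r] : Fin 1 → ℝ) j : ℝ) : ℂ)) (fun j => (((![r] : Fin 1 → ℝ) j : ℝ) : ℂ) * Complex.I))))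

/-- `X_E` contains every length-one cell (`r ≠ 0`). [folklore] -/
theorem kleinPolarCellOne_of_kleinPolarE {E : ℂ → ℂ} (hX : KleinPolarE E) {r : ℝ} (hr : r ≠ 0) :
    KleinPolarCellOne E r :=
  hX 1 ![r] (linearIndependent_unique_iff.mpr (by simpa using hr))

/-- The length-one cell at `π` HOLDS for every pinned shear (restated). [cite: Nesterenko1996SbMath, Theorem 1 and its corollaries] -/
theorem kleinPolarCellOne_pi_of (S : Shear) (hN : nesterenko) (h : S.φ Real.pi = 0) :
    KleinPolarCellOne S.E Real.pi :=
  kleinPolar_pi_cell_of S hN h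

/-- … and for `E₂`. [cite: Nesterenko1996SbMath, Theorem 1 and its corollaries] -/
theorem kleinPolarCellOne_pi_E₂ (hN : nesterenko) : KleinPolarCellOne E₂ Real.pi :=
  kleinPolar_pi_cell_E₂ hN

/-- `A ⊕ Aπ ⊂ ℝ`, the real trace of the period plane. [folklore] -/
def spanOnePi : Submodule A ℝ := Submodule.span A (Set.range ![(1 : ℝ), Real.pi])

/-- `A ⊕ Aπ` is finite-dimensional. [folklore] -/
theorem finite_spanOnePi : Module.Finite A spanOnePi :=
  Module.Finite.span_of_finite A (Set.finite_range _)

/-- `1 ∈ A ⊕ Aπ`. [folklore] -/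
theorem one_mem_spanOnePi : (1 : ℝ) ∈ spanOnePi := Submodule.subset_span ⟨0, rfl⟩

/-- `π ∈ A ⊕ Aπ`. [folklore] -/
theorem pi_mem_spanOnePi : Real.pi ∈ spanOnePi := Submodule.subset_span ⟨1, rfl⟩

/-- `log 2 ∉ A ⊕ Aπ` (Baker; part PKF01). [cite: Baker1966, 68] -/
theorem ℓ₀_not_mem_spanOnePi : ℓ₀ ∉ spanOnePi := ℓ₀_not_mem_span_one_pi

/-- A functional KILLING a finite-dimensional `F` with `φ u = 1` and `φ ℓ ≠ 0`, for any `u, ℓ ∉ F`.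
[linear algebra] [folklore] -/
theorem exists_phi_of_not_mem' (F : Submodule A ℝ) [Module.Finite A F] {u ℓ : ℝ} (hu : u ∉ F)
    (hℓ : ℓ ∉ F) : ∃ φ : ℝ →ₗ[A] A, (∀ x ∈ F, φ x = 0) ∧ φ u = 1 ∧ φ ℓ ≠ 0 := by
  by_cases h : ℓ ∈ F ⊔ Submodule.span A {u}
  · obtain ⟨k, hk⟩ := exists_pow_pi_not_mem (F ⊔ Submodule.span A {u})
    obtain ⟨φ, hF, hφu, -⟩ := exists_phi_of_not_mem F hu hk
    refine ⟨φ, hF, hφu, ?_⟩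
    obtain ⟨y, hy, z, hz, hyz⟩ := Submodule.mem_sup.mp h
    obtain ⟨c, rfl⟩ := Submodule.mem_span_singleton.mp hz
    have hc : c ≠ 0 := by
      rintro rfl
      apply hℓ
      rw [← hyz, zero_smul, add_zero]
      exact hy
    rw [← hyz, map_add, map_smul, hF y hy, hφu, zero_add, smul_eq_mul, mul_one]
    exact hc
  · obtain ⟨φ, hF, hφu, hφℓ⟩ := exists_phi_of_not_mem F hu h
    exact ⟨φ, hF, hφu, by rw [hφℓ]; exact one_ne_zero⟩

/-- **A PINNED SHEAR MOVING `r ↦ s` exists for any reals `r, s ∉ A ⊕ Aπ`.** [folklore] -/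
theorem exists_pinned_shear_moving {r s : ℝ} (hr : r ∉ spanOnePi) (hs : s ∉ spanOnePi) :
    ∃ S : Shear, S.φ Real.pi = 0 ∧ S.u = r ∧ S.ℓ = s := by
  haveI := finite_spanOnePi
  obtain ⟨φ, hF, hu, hℓ⟩ := exists_phi_of_not_mem' spanOnePi hr hs
  exact ⟨⟨φ, r, s, hF 1 one_mem_spanOnePi, hu, hℓ⟩, hF _ pi_mem_spanOnePi, rfl, rfl⟩

/-- For a shear the generators of the length-one cell at `u` are `u, iu, e^ℓ, e^{iℓ}`: all algebraic
over any `K ∋ u, e^ℓ, e^{iℓ}`. [folklore] -/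
theorem cellOne_algebraic (S : Shear) (K : IntermediateField ℚ ℂ) (hr : ((S.u : ℝ) : ℂ) ∈ K)
    (hs : cexp (S.ℓ : ℂ) ∈ K) (his : cexp ((S.ℓ : ℂ) * I) ∈ K) :
    ∀ x ∈ Set.range (Fin.append (fun j => (((![S.u] : Fin 1 → ℝ) j : ℝ) : ℂ))
        (fun j => (((![S.u] : Fin 1 → ℝ) j : ℝ) : ℂ) * Complex.I)) ∪
      Set.range (S.E ∘ Fin.append (fun j => (((![S.u] : Fin 1 → ℝ) j : ℝ) : ℂ))
        (fun j => (((![S.u] : Fin 1 → ℝ) j : ℝ) : ℂ) * Complex.I)), IsAlgebraic K x := by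
  have aI : IsAlgebraic K I := alg_I.tower_top (L := K)
  have ar : IsAlgebraic K ((S.u : ℝ) : ℂ) := alg_of_mem hr
  have hEu : S.E (S.u : ℂ) = cexp (S.ℓ : ℂ) := E_u S
  have hEuI : S.E ((S.u : ℂ) * I) = cexp ((S.ℓ : ℂ) * I) := E_u_mul_I S
  rintro x (⟨i, rfl⟩ | ⟨i, rfl⟩)
  · refine Fin.addCases (fun j => ?_) (fun j => ?_) i
    · rw [Fin.append_left]
      fin_cases j
      simpa using ar
    · rw [Fin.append_right]
      fin_cases j
      simpa using ar.mul aI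
  · refine Fin.addCases (fun j => ?_) (fun j => ?_) i
    · simp only [Function.comp_apply]
      rw [Fin.append_left]
      fin_cases j
      simpa [hEu] using alg_of_mem hs
    · simp only [Function.comp_apply]
      rw [Fin.append_right]
      fin_cases j
      simpa [hEuI] using alg_of_mem his

/-- A shear FAILS the length-one cell at `u` as soon as `trdeg ℚ(u, e^ℓ, e^{iℓ}) ≤ 1`. [folklore] -/
theorem not_kleinPolarCellOne_shear (S : Shear) (K : IntermediateField ℚ ℂ)
    (hK : Algebra.trdeg ℚ K ≤ 1) (hr : ((S.u : ℝ) : ℂ) ∈ K) (hs : cexp (S.ℓ : ℂ) ∈ K)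
    (his : cexp ((S.ℓ : ℂ) * I) ∈ K) : ¬ KleinPolarCellOne S.E S.u := by
  intro h
  have h1 := h.trans
    ((RootDecomp1EAnchor.trdeg_adjoin_le_of_isAlgebraic (cellOne_algebraic S K hr hs his)).trans hK)
  have h3 : (1 + 1 : ℕ) ≤ 1 := by exact_mod_cast h1
  omega

/-- **K5-X REDUCTION.** If ONE real pair `(r, s)` with `r, s ∉ A ⊕ Aπ` and
`trdeg ℚ(r, e^s, e^{is}) ≤ 1` is certified (a subfield `K ∋ r, e^s, e^{is}` with `trdeg K ≤ 1`),
then an exponential with the transcendence package (E1)–(E4), the TRUE kernel, the period plane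
and Nesterenko's theorem verbatim FAILS Klein-polar Schanuel already at LENGTH ONE (at `r`):
the pinned shear `r ↦ s`. Conversely a pinned shear fails a length-one cell only at a moved point
`r ∉ ker φ ⊇ A ⊕ Aπ`, with `s = θ(r) ∉ ker φ`, so for the shear family this input is also
NECESSARY. [folklore] -/
theorem kFiveX_reduction {r s : ℝ} (hr : r ∉ spanOnePi) (hs : s ∉ spanOnePi)
    (K : IntermediateField ℚ ℂ) (hK : Algebra.trdeg ℚ K ≤ 1) (hrK : ((r : ℝ) : ℂ) ∈ K)
    (hsK : cexp (s : ℂ) ∈ K) (hisK : cexp ((s : ℂ) * I) ∈ K) :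
    ∃ E : ℂ → ℂ, TranscendencePackage E ∧ TrueKernel E ∧ AgreesOnPeriodPlane E ∧
      (nesterenko → NesterenkoE E) ∧ ¬ KleinPolarCellOne E r ∧ ¬ KleinPolarE E := by
  obtain ⟨S, hφπ, hu, hℓ⟩ := exists_pinned_shear_moving hr hs
  subst hu hℓ
  have hcell := not_kleinPolarCellOne_shear S K hK hrK hsK hisK
  have hr0 : S.u ≠ 0 := by
    intro h0
    apply hr
    rw [h0]
    exact Submodule.zero_mem _
  exact ⟨S.E, transcendencePackage_shear S, trueKernel_of S hφπ, agreesOnPeriodPlane_of S hφπ,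
    fun hN => nesterenkoE_of S hN hφπ, hcell, fun hX => hcell (kleinPolarCellOne_of_kleinPolarE hX hr0)⟩

/-- **K5-X ⇐ `2cos(log 2) ∉ ℚ̄ ⊕ ℚ̄π`.** Part TPF04's pair `(u₀, ℓ₀) = (2cos log 2, log 2)`:
`e^{ℓ₀} = 2`, `e^{iℓ₀} = 2^i = w₀`, `u₀ = w₀ + w₀⁻¹ ∈ ℚ(w₀) = K₀`, `trdeg K₀ ≤ 1`, and
`log 2 ∉ A ⊕ Aπ` by Baker (PKF01) — so the ONLY uncertified input for a period-package model failing
the length-one cell at `u₀` is `u₀ ∉ A ⊕ Aπ` (as `u₀` is transcendental (TPF04), equivalently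
`π ∉ ℚ̄(2^i)`: a case of Schanuel's conjecture for `(iπ, log 2, i log 2)`, outside
HL/LW/GS/Baker/Nesterenko). [folklore] -/
theorem kFiveX_of_u₀_not_mem (hu₀ : u₀ ∉ spanOnePi) :
    ∃ E : ℂ → ℂ, TranscendencePackage E ∧ TrueKernel E ∧ AgreesOnPeriodPlane E ∧
      (nesterenko → NesterenkoE E) ∧ ¬ KleinPolarCellOne E u₀ ∧ ¬ KleinPolarE E := by
  refine kFiveX_reduction hu₀ ℓ₀_not_mem_spanOnePi K₀ trdeg_K₀_le_one u₀_mem_K₀ ?_ w₀_mem_K₀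
  rw [exp_ℓ₀]
  simp

/-! ## §8 K5-X GRANTED `SchanuelRank 3`: Schanuel's conjecture in rank three FOR `exp` ITSELF certifies
the pair `(2cos log 2, log 2)` — granted it, the period package does not even buy the length-one cell -/

/-- `iπ, log 2, i log 2` are `ℚ`-linearly independent (real parts: `log 2 ≠ 0`; imaginary parts:
`log 2 ∉ A ⊕ Aπ ⊇ ℚπ`, Baker). [cite: Baker1966, 68] -/
theorem linearIndependent_piI_ℓ₀_ℓ₀I :
    LinearIndependent ℚ ![(Real.pi : ℂ) * I, (ℓ₀ : ℂ), (ℓ₀ : ℂ) * I] := by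
  rw [Fintype.linearIndependent_iff]
  intro g hg
  rw [Fin.sum_univ_three] at hg
  simp only [Matrix.cons_val_zero, Matrix.cons_val_one, Rat.smul_def] at hg
  have h2 : (![(Real.pi : ℂ) * I, (ℓ₀ : ℂ), (ℓ₀ : ℂ) * I] 2) = (ℓ₀ : ℂ) * I := rfl
  rw [h2] at hg
  have hre := congrArg Complex.re hg
  have him := congrArg Complex.im hg
  simp only [Complex.add_re, Complex.add_im, Complex.mul_re, Complex.mul_im, Complex.ofReal_re,
    Complex.ofReal_im, Complex.I_re, Complex.I_im, Complex.ratCast_re, Complex.ratCast_im,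
    Complex.zero_re, Complex.zero_im, mul_zero, zero_mul, mul_one, sub_zero, add_zero,
    zero_add] at hre him
  -- `hre : ↑(g 1) * ℓ₀ = 0`, `him : ↑(g 0) * π + ↑(g 2) * ℓ₀ = 0`
  have hℓ : ℓ₀ ≠ 0 := ℓ₀_pos.ne'
  have hg1 : (g 1 : ℝ) = 0 := by
    rcases mul_eq_zero.mp hre with h' | h'
    · exact h'
    · exact absurd h' hℓ
  have hg2 : (g 2 : ℝ) = 0 := by
    by_contra hne
    apply ℓ₀_not_mem_span_one_pi
    have hmem : ((-(g 0 / g 2) : ℚ) : ℝ) ∈ A := mem_A_iff.mpr (isAlgebraic_algebraMap _)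
    have e : ℓ₀ = (⟨_, hmem⟩ : A) • Real.pi := by
      rw [Algebra.smul_def]
      show ℓ₀ = (((-(g 0 / g 2) : ℚ) : ℝ)) * Real.pi
      push_cast
      field_simp
      linarith
    rw [e]
    exact Submodule.smul_mem _ _ (Submodule.subset_span ⟨1, rfl⟩)
  have hg0 : (g 0 : ℝ) = 0 := by
    rw [hg2, zero_mul, add_zero] at him
    rcases mul_eq_zero.mp him with h' | h'
    · exact h'
    · exact absurd h' Real.pi_ne_zero
  intro i
  fin_cases i
  · exact_mod_cast hg0
  · exact_mod_cast hg1
  · exact_mod_cast hg2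

/-- `ℚ(π, log 2)`. [folklore] -/
def Kπℓ : IntermediateField ℚ ℂ :=
  IntermediateField.adjoin ℚ (Set.range ![(Real.pi : ℂ), (ℓ₀ : ℂ)])

/-- `trdeg_ℚ ℚ(π, log 2) ≤ 2`. [folklore] -/
theorem trdeg_Kπℓ_le : Algebra.trdeg ℚ Kπℓ ≤ ((2 : ℕ) : Cardinal) := by
  refine (RootDecomp1BTameFlagCore.trdeg_adjoin_le_cardinalMk _).trans ?_
  refine Cardinal.mk_range_le.trans ?_
  simp

/-- `π ∈ ℚ(π, log 2)`. [folklore] -/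
theorem pi_mem_Kπℓ : (Real.pi : ℂ) ∈ Kπℓ := IntermediateField.subset_adjoin ℚ _ ⟨0, rfl⟩

/-- `log 2 ∈ ℚ(π, log 2)`. [folklore] -/
theorem ℓ₀_mem_Kπℓ : (ℓ₀ : ℂ) ∈ Kπℓ := IntermediateField.subset_adjoin ℚ _ ⟨1, rfl⟩

/-- If `u₀ = 2cos log 2 ∈ A ⊕ Aπ` then `u₀` is algebraic over `ℚ(π, log 2)`. [folklore] -/
theorem u₀_isAlgebraic_of_mem (hu : u₀ ∈ spanOnePi) : IsAlgebraic Kπℓ (u₀ : ℂ) := by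
  obtain ⟨c, hc⟩ := (Submodule.mem_span_range_iff_exists_fun A).mp hu
  rw [Fin.sum_univ_two] at hc
  simp only [Matrix.cons_val_zero, Matrix.cons_val_one, Algebra.smul_def, mul_one] at hc
  have e : (u₀ : ℂ) = (((c 0 : A) : ℝ) : ℂ) + (((c 1 : A) : ℝ) : ℂ) * (Real.pi : ℂ) := by
    rw [← hc]
    push_cast
    rfl
  have h0 : IsAlgebraic Kπℓ (((c 0 : A) : ℝ) : ℂ) :=
    (mem_Qb_iff.mp (mem_A_iff_coe_mem_Qb.mp (c 0).2)).tower_top (L := Kπℓ)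
  have h1 : IsAlgebraic Kπℓ (((c 1 : A) : ℝ) : ℂ) :=
    (mem_Qb_iff.mp (mem_A_iff_coe_mem_Qb.mp (c 1).2)).tower_top (L := Kπℓ)
  rw [e]
  exact h0.add (h1.mul (alg_of_mem pi_mem_Kπℓ))

/-- **`SchanuelRank 3 ⇒ 2cos log 2 ∉ ℚ̄ ⊕ ℚ̄π`.** At the `ℚ`-free triple `(iπ, log 2, i log 2)`
Schanuel in rank three gives `trdeg ℚ(π, log 2, 2^i) = 3`; but if `u₀ = a + bπ` (`a, b ∈ A`) then
`2^i = w₀`, a root of `X² − u₀X + 1`, and all six generators are algebraic over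
`L = ℚ(π, log 2, u₀)` with `trdeg L ≤ trdeg ℚ(π, log 2) ≤ 2`. [cite: Waldschmidt2000, §1.4] -/
theorem u₀_not_mem_spanOnePi_of_schanuelRank_three (h3 : SchanuelRank 3) : u₀ ∉ spanOnePi := by
  intro hu
  have hu' := u₀_isAlgebraic_of_mem hu
  set L : IntermediateField ℚ ℂ :=
    IntermediateField.adjoin ℚ (Set.range ![(Real.pi : ℂ), (ℓ₀ : ℂ), (u₀ : ℂ)]) with hLdef
  have hπL : (Real.pi : ℂ) ∈ L := IntermediateField.subset_adjoin ℚ _ ⟨0, rfl⟩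
  have hℓL : (ℓ₀ : ℂ) ∈ L := IntermediateField.subset_adjoin ℚ _ ⟨1, rfl⟩
  have huL : (u₀ : ℂ) ∈ L := IntermediateField.subset_adjoin ℚ _ ⟨2, rfl⟩
  -- `trdeg L ≤ trdeg ℚ(π, log 2) ≤ 2`
  have hLgen : ∀ x ∈ Set.range ![(Real.pi : ℂ), (ℓ₀ : ℂ), (u₀ : ℂ)], IsAlgebraic Kπℓ x := by
    rintro x ⟨i, rfl⟩
    fin_cases i
    · simpa using alg_of_mem pi_mem_Kπℓ
    · simpa using alg_of_mem ℓ₀_mem_Kπℓ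
    · simpa using hu'
  have hL : Algebra.trdeg ℚ L ≤ ((2 : ℕ) : Cardinal) :=
    (RootDecomp1EAnchor.trdeg_adjoin_le_of_isAlgebraic hLgen).trans trdeg_Kπℓ_le
  -- `w₀ = 2^i` is algebraic over `L` (root of `X² − u₀X + 1`)
  have hw : IsAlgebraic L w₀ := by
    refine ⟨Polynomial.X ^ 2 - Polynomial.C (⟨(u₀ : ℂ), huL⟩ : L) * Polynomial.X + 1, ?_, ?_⟩
    · intro h0
      have h1 := congrArg (fun q : Polynomial L => Polynomial.eval 0 q) h0
      simp at h1
    · simp only [map_add, map_sub, map_mul, map_pow, map_one, Polynomial.aeval_X,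
        Polynomial.aeval_C, IntermediateField.algebraMap_apply]
      rw [u₀_eq]
      have hw0 := w₀_ne_zero
      field_simp
      ring
  -- the six generators of the rank-three cell are algebraic over `L`
  have aI : IsAlgebraic L I := alg_I.tower_top (L := L)
  have hgen : ∀ x ∈ Set.range ![(Real.pi : ℂ) * I, (ℓ₀ : ℂ), (ℓ₀ : ℂ) * I] ∪
      Set.range (cexp ∘ ![(Real.pi : ℂ) * I, (ℓ₀ : ℂ), (ℓ₀ : ℂ) * I]), IsAlgebraic L x := by
    rintro x (⟨i, rfl⟩ | ⟨i, rfl⟩)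
    · fin_cases i
      · simpa using (alg_of_mem hπL).mul aI
      · simpa using alg_of_mem hℓL
      · simpa using (alg_of_mem hℓL).mul aI
    · fin_cases i
      · simpa [Complex.exp_pi_mul_I] using alg_neg_one.tower_top (L := L)
      · simpa [exp_ℓ₀] using alg_two.tower_top (L := L)
      · simpa [w₀] using hw
  have key := (h3 _ linearIndependent_piI_ℓ₀_ℓ₀I).trans
    ((RootDecomp1EAnchor.trdeg_adjoin_le_of_isAlgebraic hgen).trans hL)
  have : (3 : ℕ) ≤ 2 := by exact_mod_cast key
  omega

/-- **K5-X GRANTED `SchanuelRank 3`.** If Schanuel's conjecture holds in rank three (for `exp`), then an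
exponential with (E1)–(E4), the true kernel, the period plane and Nesterenko verbatim FAILS the
length-one Klein-polar cell at `r = 2cos log 2` (the pinned shear `2cos log 2 ↦ log 2`).
[cite: Waldschmidt2000, §1.4] -/
theorem kFiveX_of_schanuelRank_three (h3 : SchanuelRank 3) :
    ∃ E : ℂ → ℂ, TranscendencePackage E ∧ TrueKernel E ∧ AgreesOnPeriodPlane E ∧
      (nesterenko → NesterenkoE E) ∧ ¬ KleinPolarCellOne E u₀ ∧ ¬ KleinPolarE E :=
  kFiveX_of_u₀_not_mem (u₀_not_mem_spanOnePi_of_schanuelRank_three h3)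

/-- **Granted `SchanuelRank 3` and Nesterenko, the LENGTH-ONE polar cells are FALSE WITHOUT a channel
beyond the period package:** `¬ ∀ E, PeriodPackage E → ∀ r ≠ 0, X_E(1) at r`. (Unconditionally this
is K5-X, open; the price without `SchanuelRank 3` is `2cos log 2 ∉ ℚ̄ ⊕ ℚ̄π`, §7.)
[cite: Nesterenko1996SbMath, Theorem 1 and its corollaries] -/
theorem kleinPolarCellOne_false_without_channel_beyond_periods_of_schanuelRank_three
    (hN : nesterenko) (h3 : SchanuelRank 3) :
    ¬ ∀ E : ℂ → ℂ, PeriodPackage E → ∀ r : ℝ, r ≠ 0 → KleinPolarCellOne E r := by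
  intro H
  obtain ⟨E, hT, hK, hP, hNE, hcell, -⟩ := kFiveX_of_schanuelRank_three h3
  exact hcell (H E ⟨hT, hK, hP, hNE hN⟩ u₀ u₀_pos.ne')

/-- … and at `E = exp` the length-one cells DO follow from the crux (dictionary). [folklore] -/
theorem kleinPolarCellOne_exp_of_kleinPolarSchanuel
    (hX : Summit.Schanuel.Schanuel.Theses.RootDecomp1B.KleinPolarSchanuel) {r : ℝ} (hr : r ≠ 0) :
    KleinPolarCellOne cexp r :=
  kleinPolarCellOne_of_kleinPolarE ((kleinPolarE_exp_iff).mpr hX) hr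

end Summit.Schanuel.Schanuel.Theorems.RootDecomp1BFinitePinningFloor

end
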